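import Summits.HodgeConjecture.CorCM.GaloisTwoPowerDescentLemmas
import Summits.HodgeConjecture.CorCM.GaloisDicyclicTimesTwoNondegenerate
import Summits.HodgeConjecture.CorCM.GaloisMinimalTwoPowerClassification
import Mathlib.GroupTheory.NoncommCoprod
import HarnessLib

/-!
# Structured `2`-power Galois CM fields are GOOD: the converse direction of the `2`-power classification

COR-CM (cell `pub-hodgecm2`), binder seat b04 (gen 35), count-neutral own lane «Galois-CM-type classification».  KERNEL ONLY:
theorems; no definition, no named fact, no `sorry`.  `HC_CM` is neither used nor claimed.

STRUCT(`K`) — the conclusion of gen 34's (R1) `CorCM/GaloisTwoPowerOrderFourClassification` and the hypothesis/conclusion shape of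
gen 35's induction `CorCM/GaloisTwoPowerClassification` — says `Gal(K/ℚ) = H·E` with `H.IsComplement' E`, `E` central of exponent
`2` with `|E| ≤ 2`, complex conjugation `c ∈ H ∖ E`, `|H| = 2^k`, `H` cyclic or `≃ QuaternionGroup (2^(k-2))`.  HERE the four cases
are identified with the GOOD rows already in the tree and packaged as ONE theorem:

* `|E| = 1`, `H` cyclic: `Gal(K/ℚ)` cyclic — gen 11 (`CyclicTwoPower`, via gen 34's `isNondegenerate_of_isCyclic_or_quaternion`);
* `|E| = 1`, `H` quaternion: `Gal(K/ℚ) ≃ Q_{2^n}` — gen 20 (`GaloisDicyclic.isNondegenerate_quaternion`);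
* `|E| = 2`, `H` cyclic: `Gal(K/ℚ)` abelian with `c` in the cyclic subgroup `H` of index `2` (condition (α)) — gens 15–16
  (`AbelianTwoPowerClassification.isNondegenerate_of_isPrimitive_of_good`);
* `|E| = 2`, `H` quaternion: `Gal(K/ℚ) ≃ Q × C₂` with `c = (a_n, 1)` — gen 30 (`GaloisDicyclic.isNondegenerate_of_isPrimitive_quaternion_times_two`);
  the isomorphism is `(h, e) ↦ h e` (`MonoidHom.noncommCoprod`, bijective by `IsComplement'`, a homomorphism since `E` is central)
  composed with `H ≃* Q` and `E ≃* Multiplicative (ZMod 2)`.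

* **`isNondegenerate_of_isPrimitive_of_struct`** — STRUCT ⟹ every primitive CM type of `K` is nondegenerate (GOOD): the Hodge ring
  of every power of every simple abelian variety with CM by `K` is generated by divisor classes.
* `sq_eq_of_struct` — STRUCT ⟹ (H2): `σ⁴ = 1 ⟹ σ² ∈ {1, c}` (in `H·E`, `(h e)² = h²` is an involution of `H`, i.e. `c`, or `1`).
* **`struct_iff_good_and_pow_four_sq`** — for `[K:ℚ] = 2^n ≥ 64`, UNCONDITIONALLY: STRUCT ⟺ GOOD ∧ (H2) (⟸ is gen 34's (R1)).

## References

* [Kubota1965] T. Kubota, *On the field extension by complex multiplication*, Trans. AMS 118 (1965), §2 and §4 Lemma 2.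
* [Shimura1998] G. Shimura, *Abelian Varieties with Complex Multiplication and Modular Functions*, §8.2 Prop. 26, §18.2.
* [Rotman1995] J. J. Rotman, *An Introduction to the Theory of Groups*, 4th ed., GTM 148, Springer 1995, Thm. 5.46.
* [Gordon1999HodgeAVSurvey] B. B. Gordon, *A survey of the Hodge conjecture for abelian varieties*, Thm. 6.4, §9.3, §9.4.3.
-/

noncomputable section

open CategoryTheory CategoryTheory.Limits NumberField
open scoped BigOperators

namespace Summit.HodgeConjecture.CorCM.GaloisModels

open Literature.NumberTheory.ComplexMultiplication
open Literature.AlgebraicGeometry.Motives (AbelianVariety CMType)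
open Literature.AlgebraicGeometry.HodgeTheory
open Literature.AlgebraicGeometry.Pohlmann1968
open Summit.HodgeConjecture.CorCM.GaloisRank

variable {K : Type} [Field K] [NumberField K] [IsCMField K] [IsGalois ℚ K]

/-- **STRUCT ⟹ GOOD.**  `K` Galois CM of degree `2^n`, `n ≥ 1`; `Gal(K/ℚ) = H·E` with `H.IsComplement' E`, `E` central of exponent
`2`, `|E| ≤ 2`, complex conjugation `c ∈ H`, `|H| = 2^k`, `H` cyclic or `≃ QuaternionGroup (2^(k-2))`.  Then every primitive CM
type of `K` is nondegenerate — the rows `C_{2^n}` (gen 11), `Q_{2^n}` (gen 20), `C_{2^(n-1)} × C₂` with `c ∈ C` (gens 15–16) and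
`Q_{2^(n-1)} × C₂` with `c ∈ Q` (gen 30) of the seat's classification. [cite: Kubota1965, §2 and §4 Lemma 2]
[cite: Shimura1998, §8.2 Prop. 26 and §18.2] [cite: Gordon1999HodgeAVSurvey, §9.3 and §9.4.3] -/
theorem isNondegenerate_of_isPrimitive_of_struct {n : ℕ} (hdeg : Module.finrank ℚ K = 2 ^ n) (hn : 1 ≤ n)
    (H E : Subgroup (K ≃ₐ[ℚ] K)) (k : ℕ) (hHE : H.IsComplement' E) (hcH : (IsCMField.complexConj K).restrictScalars ℚ ∈ H)
    (hE : ∀ e ∈ E, e * e = 1 ∧ ∀ g : K ≃ₐ[ℚ] K, g * e = e * g) (hEcard : Nat.card E ≤ 2) (hHcard : Nat.card H = 2 ^ k)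
    (hstruct : IsCyclic H ∨ (3 ≤ k ∧ Nonempty (H ≃* QuaternionGroup (2 ^ (k - 2)))))
    {Φ : CMType K} (φ₀ : K →+* ℂ) (hprim : IsPrimitive (ℂ ≃+* ℂ) Φ.1 φ₀) : IsNondegenerate Φ := by
  classical
  set c := (IsCMField.complexConj K).restrictScalars ℚ with hc
  have hcc : c * c = 1 := model_complexConj_mul_self (MulEquiv.refl (K ≃ₐ[ℚ] K)) (by simp [hc])
  have hc1 : c ≠ 1 := model_complexConj_ne_one (MulEquiv.refl (K ≃ₐ[ℚ] K)) (by simp [hc])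
  have hcard : Nat.card (K ≃ₐ[ℚ] K) = 2 ^ n := by
    rw [Nat.card_eq_fintype_card, card_model_eq_finrank (MulEquiv.refl (K ≃ₐ[ℚ] K)), hdeg]
  have hcen : ∀ e ∈ E, ∀ g : K ≃ₐ[ℚ] K, g * e = e * g := fun e he => (hE e he).2
  have hHEcard : Nat.card H * Nat.card E = 2 ^ n := by rw [hHE.card_mul, hcard]
  have hdecomp : ∀ g : K ≃ₐ[ℚ] K, ∃ h ∈ H, ∃ e ∈ E, h * e = g := fun g => by
    obtain ⟨⟨h, e⟩, rfl⟩ := hHE.2 g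
    exact ⟨h, h.2, e, e.2, rfl⟩
  have hEpos : 0 < Nat.card E := Nat.card_pos
  by_cases hE1 : Nat.card E = 1
  · /- `E = 1`: `Gal(K/ℚ) = H` is cyclic or generalised quaternion -/
    have hEbot : E = ⊥ := (Subgroup.eq_bot_iff_card E).2 hE1
    have hHtop : H = ⊤ := by
      rw [← Subgroup.card_eq_iff_eq_top, hcard, ← hHEcard, hE1, mul_one]
    have hkn : k = n := Nat.pow_right_injective le_rfl (show 2 ^ k = 2 ^ n by rw [← hHcard, ← hHEcard, hE1, mul_one])
    -- `Gal(K/ℚ) ≃* H`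
    let ι : (K ≃ₐ[ℚ] K) ≃* H := (Subgroup.topEquiv.symm.trans (MulEquiv.subgroupCongr hHtop.symm))
    refine isNondegenerate_of_isCyclic_or_quaternion hdeg hn ?_ Φ
    rcases hstruct with hcyc | ⟨-, ⟨f⟩⟩
    · exact Or.inl (isCyclic_of_surjective ι.symm ι.symm.surjective)
    · rw [hkn] at f
      exact Or.inr ⟨ι.trans f⟩
  · /- `|E| = 2` -/
    have hE2 : Nat.card E = 2 := by omega
    have hn2 : 2 ≤ n := by
      by_contra h
      have hn1 : n = 1 := by omega
      rw [hn1, pow_one, hE2] at hHEcard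
      have hH1 : Nat.card H = 1 := by omega
      haveI := (Nat.card_eq_one_iff_unique.mp hH1).1
      exact hc1 (congrArg Subtype.val (Subsingleton.elim (⟨c, hcH⟩ : H) 1))
    have hHcard' : Nat.card H = 2 ^ (n - 1) := by
      have : Nat.card H * 2 = 2 ^ (n - 1) * 2 := by
        rw [← pow_succ, Nat.sub_add_cancel (by omega : 1 ≤ n), ← hHEcard, hE2]
      exact Nat.eq_of_mul_eq_mul_right (by norm_num) this
    have hkn : k = n - 1 := Nat.pow_right_injective le_rfl (show 2 ^ k = 2 ^ (n - 1) by rw [← hHcard, hHcard'])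
    have hHidx : H.index = 2 := by
      have h1 := H.index_mul_card
      rw [hHcard', hcard, show 2 ^ n = 2 * 2 ^ (n - 1) by rw [← pow_succ', Nat.sub_add_cancel (by omega)]] at h1
      exact Nat.eq_of_mul_eq_mul_right (by positivity) h1
    rcases hstruct with hcyc | ⟨hk3, ⟨f⟩⟩
    · /- `H` cyclic: `Gal(K/ℚ)` abelian with `c` in the cyclic subgroup `H` of index `2` -/
      letI := IsCyclic.commGroup (α := H)
      have hcommH : ∀ h₁ ∈ H, ∀ h₂ ∈ H, h₁ * h₂ = h₂ * h₁ := fun h₁ hh₁ h₂ hh₂ => by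
        have := mul_comm (⟨h₁, hh₁⟩ : H) ⟨h₂, hh₂⟩
        exact congrArg Subtype.val this
      have hcomm : ∀ g₁ g₂ : K ≃ₐ[ℚ] K, g₁ * g₂ = g₂ * g₁ := by
        intro g₁ g₂
        obtain ⟨h₁, hh₁, e₁, he₁, rfl⟩ := hdecomp g₁
        obtain ⟨h₂, hh₂, e₂, he₂, rfl⟩ := hdecomp g₂
        rw [show h₁ * e₁ * (h₂ * e₂) = (h₁ * h₂) * (e₁ * e₂) by
            rw [mul_assoc, ← mul_assoc e₁, ← hcen e₁ he₁ h₂]; group,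
          show h₂ * e₂ * (h₁ * e₁) = (h₂ * h₁) * (e₂ * e₁) by
            rw [mul_assoc, ← mul_assoc e₂, ← hcen e₂ he₂ h₁]; group,
          hcommH h₁ hh₁ h₂ hh₂, hcen e₁ he₁ e₂]
      obtain ⟨gH, hgH⟩ := IsCyclic.exists_generator (α := H)
      have hHz : H = Subgroup.zpowers (gH : K ≃ₐ[ℚ] K) := by
        apply le_antisymm
        · intro s hs
          obtain ⟨i, hi⟩ := Subgroup.mem_zpowers_iff.1 (hgH ⟨s, hs⟩)
          exact Subgroup.mem_zpowers_iff.2 ⟨i, by rw [← Subgroup.coe_zpow, hi]⟩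
        · exact Subgroup.zpowers_le.2 gH.2
      refine AbelianTwoPowerClassification.isNondegenerate_of_isPrimitive_of_good hcomm (n := n - 1)
        (by rw [hdeg, Nat.sub_add_cancel (by omega)]) (Or.inl ⟨gH, ?_, ?_⟩) φ₀ hprim
      · rw [← hHz]; exact hcH
      · rw [← hHz, hHidx]
    · /- `H` quaternion: `Gal(K/ℚ) ≃ Q × C₂` with `c ↦ (a_m, 1)` -/
      set m := 2 ^ (k - 2) with hm
      haveI : NeZero m := ⟨by positivity⟩
      -- the internal direct product `H × E ≃* Gal(K/ℚ)`
      have hcommHE : ∀ (h : H) (e : E), Commute (H.subtype h) (E.subtype e) := fun h e =>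
        show (h : K ≃ₐ[ℚ] K) * e = e * h from hcen e e.2 h
      let ψ₀ : H × E →* (K ≃ₐ[ℚ] K) := MonoidHom.noncommCoprod H.subtype E.subtype hcommHE
      have hψ₀ : Function.Bijective ψ₀ := by
        have : (ψ₀ : H × E → (K ≃ₐ[ℚ] K)) = fun x => x.1.1 * x.2.1 := by
          funext x
          rfl
        rw [this]
        exact hHE
      let ψ : H × E ≃* (K ≃ₐ[ℚ] K) := MulEquiv.ofBijective ψ₀ hψ₀
      -- `E ≃* C₂`
      haveI : Fact (Nat.Prime 2) := ⟨Nat.prime_two⟩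
      have hZ2 : Nat.card (Multiplicative (ZMod 2)) = 2 := by simp
      let g : E ≃* Multiplicative (ZMod 2) := mulEquivOfPrimeCardEq hE2 hZ2
      let e : (K ≃ₐ[ℚ] K) ≃* QuaternionGroup m × Multiplicative (ZMod 2) := ψ.symm.trans (f.prodCongr g)
      have hψc : ψ (⟨c, hcH⟩, 1) = c := by
        show ψ₀ (⟨c, hcH⟩, 1) = c
        rw [MonoidHom.noncommCoprod_apply]
        simp
      have hec : e c = (QuaternionGroup.a m, 1) := by
        have h1 : ψ.symm c = (⟨c, hcH⟩, 1) := by rw [MulEquiv.symm_apply_eq]; exact hψc.symm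
        have h2 : e c = (f ⟨c, hcH⟩, g 1) := by
          show (f.prodCongr g) (ψ.symm c) = _
          rw [h1]
          rfl
        rw [h2, map_one]
        congr 1
        refine GaloisDicyclic.eq_a_of_mul_self_eq_one _ ?_ ?_
        · rw [← map_mul, ← map_one f]
          congr 1
          exact Subtype.ext hcc
        · intro h
          exact hc1 (congrArg Subtype.val (f.injective (h.trans (map_one f).symm)))
      exact GaloisDicyclic.isNondegenerate_of_isPrimitive_quaternion_times_two (n := m) (k := k - 2) hm e hec φ₀ hprim

/-- **STRUCT ⟹ (H2)**: in `Gal(K/ℚ) = H·E` as above, every `σ` with `σ⁴ = 1` has `σ² ∈ {1, c}` (`σ = h e`, `σ² = h²` is `1` or an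
involution of `H`, and the only involution of `H` is `c`). [cite: Rotman1995, Thm. 5.46] -/
theorem sq_eq_of_struct (H E : Subgroup (K ≃ₐ[ℚ] K)) (k : ℕ) (hHE : H.IsComplement' E)
    (hcH : (IsCMField.complexConj K).restrictScalars ℚ ∈ H)
    (hE : ∀ e ∈ E, e * e = 1 ∧ ∀ g : K ≃ₐ[ℚ] K, g * e = e * g) (hHcard : Nat.card H = 2 ^ k)
    (hstruct : IsCyclic H ∨ (3 ≤ k ∧ Nonempty (H ≃* QuaternionGroup (2 ^ (k - 2)))))
    (σ : K ≃ₐ[ℚ] K) (hσ : σ ^ 4 = 1) : σ * σ = 1 ∨ σ * σ = (IsCMField.complexConj K).restrictScalars ℚ := by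
  classical
  set c := (IsCMField.complexConj K).restrictScalars ℚ with hc
  have hcc : c * c = 1 := model_complexConj_mul_self (MulEquiv.refl (K ≃ₐ[ℚ] K)) (by simp [hc])
  have hc1 : c ≠ 1 := model_complexConj_ne_one (MulEquiv.refl (K ≃ₐ[ℚ] K)) (by simp [hc])
  -- every involution of `H` is `c`
  have hinv : ∀ s ∈ H, s * s = 1 → s ≠ 1 → s = c := by
    rcases hstruct with hcyc | ⟨-, ⟨f⟩⟩
    · obtain ⟨gH, hgH⟩ := IsCyclic.exists_generator (α := H)
      have hog : orderOf (gH : K ≃ₐ[ℚ] K) = 2 ^ k := by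
        rw [Subgroup.orderOf_coe, orderOf_eq_card_of_forall_mem_zpowers hgH, hHcard]
      have hmem : ∀ s : K ≃ₐ[ℚ] K, s ∈ H → s ∈ Subgroup.zpowers (gH : K ≃ₐ[ℚ] K) := by
        intro s hs
        obtain ⟨i, hi⟩ := Subgroup.mem_zpowers_iff.1 (hgH ⟨s, hs⟩)
        exact Subgroup.mem_zpowers_iff.2 ⟨i, by rw [← Subgroup.coe_zpow, hi]⟩
      intro s hs hss hs1
      exact involution_eq_of_mem_zpowers hog (hmem s hs) hss hs1 (hmem c hcH) hcc hc1
    · haveI : NeZero (2 ^ (k - 2)) := ⟨by positivity⟩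
      obtain ⟨a', -, -, -, -, -, -, -, hinvol⟩ := exists_index_two_data_of_mulEquiv_quaternionGroup H f
      intro s hs hss hs1
      rw [hinvol s hs hss hs1, ← hinvol c hcH hcc hc1]
  obtain ⟨⟨h, e⟩, hhe⟩ := hHE.2 σ
  change (h : K ≃ₐ[ℚ] K) * e = σ at hhe
  have heh : (h : K ≃ₐ[ℚ] K) * e = e * h := (hE e e.2).2 h
  have hσσ : σ * σ = (h : K ≃ₐ[ℚ] K) * h := by
    rw [← hhe]
    calc (h : K ≃ₐ[ℚ] K) * e * (h * e) = h * (e * h) * e := by group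
      _ = h * (h * e) * e := by rw [← heh]
      _ = h * h * (e * e) := by group
      _ = h * h := by rw [(hE e e.2).1, mul_one]
  have h4 : ((h : K ≃ₐ[ℚ] K) * h) * (h * h) = 1 := by
    rw [← hσσ, show σ * σ * (σ * σ) = σ ^ 4 by simp only [pow_succ, pow_zero, one_mul, mul_assoc]]
    exact hσ
  by_cases h1 : (h : K ≃ₐ[ℚ] K) * h = 1
  · exact Or.inl (hσσ.trans h1)
  · exact Or.inr (hσσ.trans (hinv _ (H.mul_mem h.2 h.2) h4 h1))

/-- **STRUCT ⟺ GOOD ∧ (H2), unconditionally for `[K:ℚ] = 2^n ≥ 64`.**  A Galois CM field `K` of degree `2^n`, `n ≥ 6`, has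
`Gal(K/ℚ) = H·E` (`E` central of exponent `2`, `|E| ≤ 2`, `c ∈ H ∖ E`, `H` cyclic or generalised quaternion) if and only if every
primitive CM type of `K` is nondegenerate AND every `σ` with `σ⁴ = 1` has `σ² ∈ {1, c}` (⟸ is gen 34's (R1)).
[cite: Rotman1995, Thm. 5.46] [cite: Shimura1998, §8.2 Prop. 26 and §18.2] [cite: Kubota1965, §2 and §4 Lemma 2] -/
theorem struct_iff_good_and_pow_four_sq {n : ℕ} (hdeg : Module.finrank ℚ K = 2 ^ n) (hn : 6 ≤ n) :
    (∃ (H E : Subgroup (K ≃ₐ[ℚ] K)) (k : ℕ), H.IsComplement' E ∧ (IsCMField.complexConj K).restrictScalars ℚ ∈ H ∧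
      (IsCMField.complexConj K).restrictScalars ℚ ∉ E ∧ (∀ e ∈ E, e * e = 1 ∧ ∀ g : K ≃ₐ[ℚ] K, g * e = e * g) ∧
      Nat.card E ≤ 2 ∧ Nat.card H = 2 ^ k ∧ (IsCyclic H ∨ (3 ≤ k ∧ Nonempty (H ≃* QuaternionGroup (2 ^ (k - 2)))))) ↔
    ((∀ (Φ : CMType K) (φ : K →+* ℂ), IsPrimitive (ℂ ≃+* ℂ) Φ.1 φ → IsNondegenerate Φ) ∧
      ∀ σ : K ≃ₐ[ℚ] K, σ ^ 4 = 1 → σ * σ = 1 ∨ σ * σ = (IsCMField.complexConj K).restrictScalars ℚ) := by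
  constructor
  · rintro ⟨H, E, k, hHE, hcH, -, hE, hEcard, hHcard, hstruct⟩
    exact ⟨fun Φ φ hprim => isNondegenerate_of_isPrimitive_of_struct hdeg (by omega) H E k hHE hcH hE hEcard hHcard hstruct
      φ hprim, sq_eq_of_struct H E k hHE hcH hE hHcard hstruct⟩
  · rintro ⟨hgood, hsq⟩
    exact exists_isComplement'_card_le_two_of_forall_isNondegenerate hdeg hn hgood hsq

end Summit.HodgeConjecture.CorCM.GaloisModels
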